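import Summits.CriticalPhenomena.PercolationContinuityZ3.Theorems.SahiConjecture
import HarnessLib

/-!
# `NoHeavyLowerTail` (stmt-CriticalPhenomena-4575) — the OPEN increasing E3GRP rows of sunflower type
# (`T_inc`, `γ`, `β`), stated at MEASURE level (E3GRP switching line, cell `prim-e3grp`)

Support file (`--supports stmt-CriticalPhenomena-4575`).  STATEMENTS FIRST (cell rule): the targets of the
E3GRP-by-switching line `prim-e3grp-switch-3` are recorded as named `Prop`s in the tree's vocabulary
(`sahiE3`, `prodBernoulli`, `openConn`, group connections as in `sahiE3_groupConn_nonneg_of_kahnConjecture`);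
no new mathematical notion is introduced.

After the decreasing E3GRP rows fell (`HybridThreePointLB.sahiE3_hybrid_nonneg`, `GroupThreePointLB…`; prim-bnk-1:
all 43 decreasing rows of the E3GRP-77 dictionary are instances), the open increasing rows split (prim-ineq-gen-8 g4)
into the SUNFLOWER class `{β, γ, r4, r5, r6}` — Sahi's `E₃` of the complements of a decreasing three-petal sunflower of
group separations, `= (1 + k)(k r − e₂(x)) − e₃(x)` with `k` = core, `x_i` = petals, `r` = rest
(`Literature…sahiE3_compl_sunflower_eq`) — and a second shape `{α, r7, r8}`.  The sunflower class has two
generators: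
* `TIncRow` — **T_inc**, three terminals: `0 ≤ E₃({a↔b}∪{a↔c}, {a↔b}∪{b↔c}, {a↔c}∪{b↔c})`, the increasing twin of
  `3PT-LB` (`= (1+q)·AG − e₃` versus `3PT-LB = (1+t)·AG − e₃`, `TIncRow` partial results in
  `…NoHeavyLowerTailTIncRowPartial`: proved for `μ(abc) ≤ μ(a|b|c)`).  `β = E₃(lnk[a|bcy], lnk[ab|cy], lnk[acy|b])`
  is `T_inc` on the quotient `G/{c = y}`; `γ` with `y` isolated is `T_inc`.  Kernel theorem for `n ≤ 5`
  (`…HybridRowsLeFive`), comb-positive on `K₆`; tight to first order on dense stars `K_{1,3}`.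
* `GammaRow` — **γ**, four terminals: `0 ≤ E₃(lnk[ab|cy], lnk[ac|by], lnk[ay|bc])` (the three perfect matchings;
  core of the dual sunflower = `a|b|c|y`); `r4` is `γ` on `(o,a₁,a₂,a₃)`.
* `BetaRow` — **β** as printed in the harness (`lnk[a|bcy], lnk[ab|cy], lnk[acy|b]`), recorded separately because the
  quotient reduction to `TIncRow` is not yet in the tree.
All three are instances of Kahn's Conjecture 5 (`tIncRow_of_kahnConjecture`, `gammaRow_of_kahnConjecture`,
`betaRow_of_kahnConjecture`); all three are OPEN (census: 0 violations in ttrl's 4-terminal dictionaries, n ≤ 6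
exhaustive × 7 densities; E3GRP-77 rows 0 / 3.1e6).  Nothing here is used as a hypothesis elsewhere except by name.
-/

noncomputable section

namespace Summit.CriticalPhenomena.PercolationContinuityZ3.Theorems

open MeasureTheory
open Literature.Probability.LatticeModels (prodBernoulli sahiE3)
open Literature.Probability.Percolation

/-- **T_inc — the increasing twin of 3PT-LB.**  For every finite weighted graph and vertices `a b c`:
`0 ≤ E₃(N_a, N_b, N_c)` with `N_a = {a↔b} ∪ {a↔c}` ("`a` is joined to one of the other two", the group connection
`lnk[a|bc]`), `N_b = {a↔b} ∪ {b↔c}`, `N_c = {a↔c} ∪ {b↔c}`; equivalently `(1 + q)(q t − e₂(u)) ≥ e₃(u)` in the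
five three-point cells.  Instance of Kahn's Conjecture 5 / Sahi's `C_3` for product measures; OPEN (harness row
`T_inc`; proved for `n ≤ 5` by kernel and for `μ(abc) ≤ μ(a|b|c)` in `…TIncRowPartial`).
[cite: Kahn2022, Conj. 5 (arXiv p. 3)] [status: open] -/
@[conjecture] def TIncRow : Prop :=
  ∀ (V : Type) [Fintype V] (w : Sym2 V → unitInterval) (a b c : V),
    0 ≤ sahiE3 (prodBernoulli w) (openConn a b ∪ openConn a c) (openConn a b ∪ openConn b c)
      (openConn a c ∪ openConn b c)

/-- **γ — the perfect-matching group-connection row.**  For every finite weighted graph and vertices `a b c y`: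
`0 ≤ E₃(lnk[ab|cy], lnk[ac|by], lnk[ay|bc])`, where `lnk[X|Y] = {some open path from X to Y}`.  The complements
`D[ab|cy], D[ac|by], D[ay|bc]` form a decreasing sunflower with core `a|b|c|y`, so the row reads
`(1 + k)(k r − e₂(x)) ≥ e₃(x)` (`k = μ(a|b|c|y)`, `x_i = μ(D_i ∖ core)`, `r = μ(all three lnk)`).  Instance of Kahn's
Conjecture 5; OPEN (harness class `γ`; `r4` is this row on `(o,a₁,a₂,a₃)`).
[cite: Kahn2022, Conj. 5 (arXiv p. 3)] [status: open] -/
@[conjecture] def GammaRow : Prop :=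
  ∀ (V : Type) [Fintype V] (w : Sym2 V → unitInterval) (a b c y : V),
    0 ≤ sahiE3 (prodBernoulli w)
      {ω : BondConfig V | ∃ x ∈ ({a, b} : Set V), ∃ z ∈ ({c, y} : Set V), (openGraph ω).Reachable x z}
      {ω : BondConfig V | ∃ x ∈ ({a, c} : Set V), ∃ z ∈ ({b, y} : Set V), (openGraph ω).Reachable x z}
      {ω : BondConfig V | ∃ x ∈ ({a, y} : Set V), ∃ z ∈ ({b, c} : Set V), (openGraph ω).Reachable x z}

/-- **β — the harness row `(lnk[a|bcy], lnk[ab|cy], lnk[acy|b])`.**  For every finite weighted graph and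
`a b c y`: `0 ≤ E₃(lnk[a|bcy], lnk[ab|cy], lnk[acy|b])`.  Its complements form a decreasing sunflower with core
`a|b|cy` ("`a` and `b` singletons"); it is `TIncRow` on the quotient graph `G/{c = y}`.  Instance of Kahn's
Conjecture 5; OPEN (harness class `β`). [cite: Kahn2022, Conj. 5 (arXiv p. 3)] [status: open] -/
@[conjecture] def BetaRow : Prop :=
  ∀ (V : Type) [Fintype V] (w : Sym2 V → unitInterval) (a b c y : V),
    0 ≤ sahiE3 (prodBernoulli w)
      {ω : BondConfig V | ∃ x ∈ ({a} : Set V), ∃ z ∈ ({b, c, y} : Set V), (openGraph ω).Reachable x z}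
      {ω : BondConfig V | ∃ x ∈ ({a, b} : Set V), ∃ z ∈ ({c, y} : Set V), (openGraph ω).Reachable x z}
      {ω : BondConfig V | ∃ x ∈ ({a, c, y} : Set V), ∃ z ∈ ({b} : Set V), (openGraph ω).Reachable x z}

/-- **Kahn's Conjecture 5 ⇒ T_inc** (three increasing events). [cite: Kahn2022, Conj. 5 (arXiv p. 3)] -/
theorem tIncRow_of_kahnConjecture (hK : KahnConjecture) : TIncRow := by
  intro V _ w a b c
  exact hK (Sym2 V) w _ _ _ ((isUpperSet_openConn a b).union (isUpperSet_openConn a c))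
    ((isUpperSet_openConn a b).union (isUpperSet_openConn b c))
    ((isUpperSet_openConn a c).union (isUpperSet_openConn b c))

/-- **Kahn's Conjecture 5 ⇒ γ** (three increasing group connections). [cite: Kahn2022, Conj. 5 (arXiv p. 3)] -/
theorem gammaRow_of_kahnConjecture (hK : KahnConjecture) : GammaRow := by
  intro V _ w a b c y
  exact sahiE3_groupConn_nonneg_of_kahnConjecture hK w _ _ _ _ _ _

/-- **Kahn's Conjecture 5 ⇒ β**. [cite: Kahn2022, Conj. 5 (arXiv p. 3)] -/
theorem betaRow_of_kahnConjecture (hK : KahnConjecture) : BetaRow := by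
  intro V _ w a b c y
  exact sahiE3_groupConn_nonneg_of_kahnConjecture hK w _ _ _ _ _ _

end Summit.CriticalPhenomena.PercolationContinuityZ3.Theorems

end
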